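import Mathlib
import Literature.Combinatorics.Additive.TripleProductProperty
import Literature.Computability.AutomaticStructures.AutomaticBlock

/-!
# Chart designs in the CYCLIC group `ℤ/ℓ^k`: the decisive-bigram criterion (no punctures)

Route `MatrixMultiplication/AutomaticSTPPDesigns`, crux `stmt-MatrixMultiplication-7357`
(`AutomaticDesignBelowFourFifths`), line `Sketch`; support lemma (a construction mechanism for the open
stub C⁺ = "one finite STPP design in a cyclic group with `∑ (|A||B||C|)^{4/5} > N`").

Cohn–Kleinberg–Szegedy–Umans 2005, Thm. 37 (tree: `CohnKleinbergSzegedyUmans2005_thm37`): for an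
`H`-chart `(Γ, A, B, C)` and a local chart-USP `U ⊆ Γ^k` the digit boxes `A_u = ∏_t A(u_t)` form an STPP
family in the bounded-exponent group `H^k`. Read in the cyclic group `ℤ/ℓ^k` (digits `A(x) ⊆ [0, ℓ)`,
`A_u = {∑_t a_t ℓ^t}`), the same boxes obey the STPP relation digit by digit WITH CARRIES
(`Literature.Computability.AutomaticStructures.stppSum_eq_zero_iff`), and a plain local chart-USP is not
enough (carries emitted at a "bad" coordinate rescue relations at a "good" one; computed failures in
`ℤ/5^5`, `ℤ/5^6`, `ℤ/7^3`, evidence `analysis-c1.md`). This file proves a carry-tolerant version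
WITHOUT shrinking the digit sets:

* `cyclicChart_addSimultaneousTPP` — if every symbol's digit triple is TPP mod `ℓ` and **diagonally
  tame** (`|(a−a')+(b−b')+(c−c')| ≤ ℓ − 3` over `ℤ`), and for every index triple `(i, j, m)` not all equal
  some coordinate `t` carries a GOOD pattern (`ℓ ∤ (a−a')+(b−b')+(c−c')` for digits from
  `A(uᵢₜ) × A(uⱼₜ) × B(uⱼₜ) × B(uₘₜ) × C(uₘₜ) × C(uᵢₜ)`, CKSU's hypergraph condition) which is either the
  lowest coordinate or PRECEDED BY A DIAGONAL one (`uᵢ,ₜ₋₁ = uⱼ,ₜ₋₁ = uₘ,ₜ₋₁`), then the digit boxes form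
  an STPP family in `ℤ/ℓ^k`.
  Proof: along a solution the carries stay in `[-2, 2]` (`|e_t| ≤ 3(ℓ-1)`); a diagonal digit receiving a
  carry `|c| ≤ 2` must satisfy `e + c ≡ 0 (mod ℓ)` with `|e + c| ≤ ℓ − 1`, so `e + c = 0` and it EMITS carry
  `0`; a good digit receiving carry `0` is impossible. For equal indices every digit is diagonal, the
  carries vanish one by one and the symbol TPP forces equal digits.

For the 3-symbol chart of CKSU (p. 11; `Ĥ = ℤ/ℓ ∖ {0,1}`, two singletons and one interval per symbol)
diagonal tameness holds, so "bigram-local USPs" index honest cyclic designs of full volume `(ℓ−2)` per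
coordinate; their capacity is not known (the USP capacity `3/2^{2/3}` would give `τ* = 0.8012` at
`ℓ = 10`, still above `4/5`: this mechanism alone cannot close the crux, see the census).
-/

-- single-conjunct summit: the mandated namespace repeats `MatrixMultiplication`.
set_option linter.dupNamespace false

namespace Summit.MatrixMultiplication.MatrixMultiplication.Theorems

namespace AutomaticDesignBelowFourFifths

open Finset Literature.Combinatorics.Additive Literature.Computability.AutomaticStructures

/-- Carries of a solution of the STPP digit recursion stay in `[-2, 2]` (sharpening the tree's
`abs_carry_le_three`: `|e_t| ≤ 3(ℓ − 1)` and `|c_t| ≤ 2` give `ℓ |c_{t+1}| ≤ 3ℓ − 1 < 3ℓ`). [folklore] -/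
theorem abs_carry_le_two {ℓ k : ℕ} (hℓ : 0 < ℓ) (a a' b b' c c' : Fin k → Fin ℓ)
    {cr : Fin (k + 1) → ℤ} (h0 : cr 0 = 0)
    (hrel : ∀ t : Fin k, cr t.castSucc + stppDigit a a' b b' c c' t = ℓ * cr t.succ) :
    ∀ t : Fin (k + 1), |cr t| ≤ 2 := by
  intro t
  induction t using Fin.induction with
  | zero => simp [h0]
  | succ t ih =>
    have hℓ' : (0 : ℤ) < ℓ := by exact_mod_cast hℓ
    have hd := abs_stppDigit_le a a' b b' c c' t
    have h1 : (ℓ : ℤ) * |cr t.succ| ≤ 3 * ℓ - 1 := by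
      calc (ℓ : ℤ) * |cr t.succ| = |cr t.castSucc + stppDigit a a' b b' c c' t| := by
            rw [hrel t, abs_mul, abs_of_pos hℓ']
        _ ≤ |cr t.castSucc| + |stppDigit a a' b b' c c' t| := abs_add_le _ _
        _ ≤ 2 + 3 * ((ℓ : ℤ) - 1) := add_le_add ih hd
        _ = 3 * ℓ - 1 := by ring
    -- `ℓ |c| ≤ 3ℓ - 1 < 3ℓ` forces `|c| ≤ 2`
    by_contra hlt
    push Not at hlt
    have h3 : (3 : ℤ) ≤ |cr t.succ| := by omega
    have : (ℓ : ℤ) * 3 ≤ ℓ * |cr t.succ| := mul_le_mul_of_nonneg_left h3 hℓ'.le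
    omega

/-- **Chart designs in `ℤ/ℓ^k`, decisive-bigram criterion.** Digit sets `A, B, C : Γ → Finset (Fin ℓ)`
with (1) every symbol triple TPP mod `ℓ`, (2) every symbol triple diagonally tame
(`|(a−a')+(b−b')+(c−c')| ≤ ℓ − 3`), indexed by rows `u : Fin L → Fin k → Γ` such that (3) every index
triple `(i, j, m)` not all equal has a coordinate `t` with a good pattern (no digit relation divisible
by `ℓ`) that is the lowest coordinate or is preceded by a diagonal coordinate: then the digit boxes
`A_i = {[a]_ℓ : a_t ∈ A(u i t)}`, `B_i`, `C_i` form an STPP family (CKSU Def. 5.1) in `ℤ/ℓ^k`.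
Cyclic, puncture-free analogue of CKSU 2005 Thm. 37. [cite: CohnKleinbergSzegedyUmans2005, Thm. 37] -/
theorem cyclicChart_addSimultaneousTPP {Γ : Type*} {ℓ k L : ℕ} [NeZero ℓ]
    (A B C : Γ → Finset (Fin ℓ)) (u : Fin L → Fin k → Γ)
    (hTPP : ∀ x : Γ, ∀ a ∈ A x, ∀ a' ∈ A x, ∀ b ∈ B x, ∀ b' ∈ B x, ∀ c ∈ C x, ∀ c' ∈ C x,
      (ℓ : ℤ) ∣ ((a : ℤ) - a') + ((b : ℤ) - b') + ((c : ℤ) - c') → a = a' ∧ b = b' ∧ c = c')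
    (hdiag : ∀ x : Γ, ∀ a ∈ A x, ∀ a' ∈ A x, ∀ b ∈ B x, ∀ b' ∈ B x, ∀ c ∈ C x, ∀ c' ∈ C x,
      |((a : ℤ) - a') + ((b : ℤ) - b') + ((c : ℤ) - c')| ≤ (ℓ : ℤ) - 3)
    (hU : ∀ i j m : Fin L, ¬(i = j ∧ j = m) → ∃ t : Fin k,
      (∀ a ∈ A (u i t), ∀ a' ∈ A (u j t), ∀ b ∈ B (u j t), ∀ b' ∈ B (u m t), ∀ c ∈ C (u m t),
        ∀ c' ∈ C (u i t), ¬ (ℓ : ℤ) ∣ ((a : ℤ) - a') + ((b : ℤ) - b') + ((c : ℤ) - c')) ∧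
      ((t : ℕ) = 0 ∨ ∃ t' : Fin k, (t' : ℕ) + 1 = t ∧ u i t' = u j t' ∧ u j t' = u m t')) :
    AddSimultaneousTPP (G := ZMod (ℓ ^ k))
      (fun i => (Fintype.piFinset fun t => A (u i t)).image fun d => (digitValue d : ZMod (ℓ ^ k)))
      (fun i => (Fintype.piFinset fun t => B (u i t)).image fun d => (digitValue d : ZMod (ℓ ^ k)))
      (fun i => (Fintype.piFinset fun t => C (u i t)).image fun d => (digitValue d : ZMod (ℓ ^ k))) := by
  have hℓ : 0 < ℓ := Nat.pos_of_ne_zero (NeZero.ne ℓ)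
  have hℓz : (ℓ : ℤ) ≠ 0 := by exact_mod_cast hℓ.ne'
  -- the carry form of a relation `[a] - [a'] + [b] - [b'] + [c] - [c'] = 0`
  have carries : ∀ a a' b b' c c' : Fin k → Fin ℓ,
      (digitValue a : ZMod (ℓ ^ k)) + -(digitValue a' : ZMod (ℓ ^ k)) + (digitValue b : ZMod (ℓ ^ k))
        + -(digitValue b' : ZMod (ℓ ^ k)) + (digitValue c : ZMod (ℓ ^ k)) + -(digitValue c' : ZMod (ℓ ^ k))
        = 0 →
      ∃ cr : Fin (k + 1) → ℤ, cr 0 = 0 ∧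
        (∀ t : Fin k, cr t.castSucc + stppDigit a' a b' b c' c t = ℓ * cr t.succ) ∧
        ∀ t : Fin (k + 1), |cr t| ≤ 2 := by
    intro a a' b b' c c' h
    have h' : ((digitValue a : ZMod (ℓ ^ k)) - digitValue a') + ((digitValue b : ZMod (ℓ ^ k)) -
        digitValue b') + ((digitValue c : ZMod (ℓ ^ k)) - digitValue c') = 0 := by
      rw [← h]; abel
    obtain ⟨cr, h0, hrel⟩ := (stppSum_eq_zero_iff hℓ a' a b' b c' c).1 h'
    exact ⟨cr, h0, hrel, abs_carry_le_two hℓ a' a b' b c' c h0 hrel⟩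
  -- `stppDigit a' a b' b c' c t = (a_t - a'_t) + (b_t - b'_t) + (c_t - c'_t)`
  have hdigit : ∀ (a a' b b' c c' : Fin k → Fin ℓ) (t : Fin k), stppDigit a' a b' b c' c t =
      ((a t : ℤ) - a' t) + ((b t : ℤ) - b' t) + ((c t : ℤ) - c' t) := by
    intro a a' b b' c c' t
    simp only [stppDigit]
  refine ⟨fun i => ?_, fun i j m => ?_⟩
  · -- clause (i): triple product property of each block triple
    intro s hs s' hs' tt htt tt' htt' v hv v' hv' h
    simp only [mem_image, Fintype.mem_piFinset] at hs hs' htt htt' hv hv'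
    obtain ⟨a, ha, rfl⟩ := hs
    obtain ⟨a', ha', rfl⟩ := hs'
    obtain ⟨b, hb, rfl⟩ := htt
    obtain ⟨b', hb', rfl⟩ := htt'
    obtain ⟨c, hc, rfl⟩ := hv
    obtain ⟨c', hc', rfl⟩ := hv'
    have h' : (digitValue a : ZMod (ℓ ^ k)) + -(digitValue a' : ZMod (ℓ ^ k)) +
        (digitValue b : ZMod (ℓ ^ k)) + -(digitValue b' : ZMod (ℓ ^ k)) +
        (digitValue c : ZMod (ℓ ^ k)) + -(digitValue c' : ZMod (ℓ ^ k)) = 0 := by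
      rw [← h]; abel
    obtain ⟨cr, h0, hrel, -⟩ := carries a a' b b' c c' h'
    -- all carries vanish and all digits agree, by induction on the position
    have key : ∀ t : Fin k, cr t.castSucc = 0 → a t = a' t ∧ b t = b' t ∧ c t = c' t ∧ cr t.succ = 0 := by
      intro t hct
      have hr := hrel t
      rw [hct, zero_add, hdigit] at hr
      have hdvd : (ℓ : ℤ) ∣ ((a t : ℤ) - a' t) + ((b t : ℤ) - b' t) + ((c t : ℤ) - c' t) :=
        ⟨cr t.succ, hr⟩
      obtain ⟨h1, h2, h3⟩ := hTPP (u i t) _ (ha t) _ (ha' t) _ (hb t) _ (hb' t) _ (hc t) _ (hc' t) hdvd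
      refine ⟨h1, h2, h3, ?_⟩
      rw [h1, h2, h3, sub_self, sub_self, sub_self, add_zero, add_zero] at hr
      have : (ℓ : ℤ) * cr t.succ = 0 := hr.symm
      exact (mul_eq_zero.1 this).resolve_left hℓz
    have hzero : ∀ t : Fin (k + 1), cr t = 0 := by
      intro t
      induction t using Fin.induction with
      | zero => exact h0
      | succ t ih => exact (key t ih).2.2.2
    have hall : ∀ t : Fin k, a t = a' t ∧ b t = b' t ∧ c t = c' t := fun t =>
      let ⟨h1, h2, h3, _⟩ := key t (hzero t.castSucc)
      ⟨h1, h2, h3⟩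
    have ea : a = a' := funext fun t => (hall t).1
    have eb : b = b' := funext fun t => (hall t).2.1
    have ec : c = c' := funext fun t => (hall t).2.2
    exact ⟨by rw [ea], by rw [eb], by rw [ec]⟩
  · -- clause (ii): simultaneity
    intro s hs s' hs' tt htt tt' htt' v hv v' hv' h
    by_contra hne
    simp only [mem_image, Fintype.mem_piFinset] at hs hs' htt htt' hv hv'
    obtain ⟨a, ha, rfl⟩ := hs
    obtain ⟨a', ha', rfl⟩ := hs'
    obtain ⟨b, hb, rfl⟩ := htt
    obtain ⟨b', hb', rfl⟩ := htt'
    obtain ⟨c, hc, rfl⟩ := hv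
    obtain ⟨c', hc', rfl⟩ := hv'
    obtain ⟨cr, h0, hrel, hbd⟩ := carries a a' b b' c c' h
    obtain ⟨t, hgood, hpos⟩ := hU i j m hne
    -- the carry entering the good coordinate `t` is `0`
    have hct : cr t.castSucc = 0 := by
      rcases hpos with ht0 | ⟨t', ht', e1, e2⟩
      · have : t.castSucc = 0 := Fin.ext (by simpa using ht0)
        rw [this, h0]
      · -- coordinate `t'` is diagonal: `|e + c| ≤ ℓ - 1` and `e + c = ℓ · c'` force `c' = 0`
        have hsucc : t'.succ = t.castSucc := Fin.ext (by simp [ht'])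
        have hr := hrel t'
        rw [hdigit] at hr
        have hx1 : u j t' = u i t' := e1.symm
        have hx2 : u m t' = u i t' := (e1.trans e2).symm
        have he := hdiag (u i t') _ (ha t') _ (hx1 ▸ ha' t') _ (hx1 ▸ hb t') _ (hx2 ▸ hb' t')
          _ (hx2 ▸ hc t') _ (hc' t')
        have hc2 := hbd t'.castSucc
        have hℓ' : (0 : ℤ) < ℓ := by exact_mod_cast hℓ
        have hbound : (ℓ : ℤ) * |cr t'.succ| ≤ ℓ - 1 := by
          calc (ℓ : ℤ) * |cr t'.succ|
              = |cr t'.castSucc + (((a t' : ℤ) - a' t') + ((b t' : ℤ) - b' t') + ((c t' : ℤ) - c' t'))| := by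
                rw [hr, abs_mul, abs_of_pos hℓ']
            _ ≤ |cr t'.castSucc| + |((a t' : ℤ) - a' t') + ((b t' : ℤ) - b' t') + ((c t' : ℤ) - c' t')| :=
                abs_add_le _ _
            _ ≤ 2 + ((ℓ : ℤ) - 3) := add_le_add hc2 he
            _ = ℓ - 1 := by ring
        have hz : cr t'.succ = 0 := by
          by_contra hz
          have h1 : (1 : ℤ) ≤ |cr t'.succ| := Int.one_le_abs hz
          have : (ℓ : ℤ) * 1 ≤ ℓ * |cr t'.succ| := mul_le_mul_of_nonneg_left h1 hℓ'.le
          omega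
        rw [← hsucc, hz]
    -- … so the good coordinate's relation would be divisible by `ℓ`
    have hr := hrel t
    rw [hct, zero_add, hdigit] at hr
    exact hgood _ (ha t) _ (ha' t) _ (hb t) _ (hb' t) _ (hc t) _ (hc' t) ⟨cr t.succ, hr⟩

/-! ### Registered sub-goal (stub) of crux `stmt-MatrixMultiplication-7357`, closed form -/

/-- **Registered stub `stub_cyclicChart`** (closed form of `cyclicChart_addSimultaneousTPP`).
[cite: CohnKleinbergSzegedyUmans2005, Thm. 37] -/
theorem stub_cyclicChart : ∀ (Γ : Type) (ℓ k L : ℕ) [NeZero ℓ] (A B C : Γ → Finset (Fin ℓ)) (u : Fin L → Fin k → Γ), (∀ x : Γ, ∀ a ∈ A x, ∀ a' ∈ A x, ∀ b ∈ B x, ∀ b' ∈ B x, ∀ c ∈ C x, ∀ c' ∈ C x, (ℓ : ℤ) ∣ ((a : ℤ) - a') + ((b : ℤ) - b') + ((c : ℤ) - c') → a = a' ∧ b = b' ∧ c = c') → (∀ x : Γ, ∀ a ∈ A x, ∀ a' ∈ A x, ∀ b ∈ B x, ∀ b' ∈ B x, ∀ c ∈ C x, ∀ c' ∈ C x, |((a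 : ℤ) - a') + ((b : ℤ) - b') + ((c : ℤ) - c')| ≤ (ℓ : ℤ) - 3) → (∀ i j m : Fin L, ¬(i = j ∧ j = m) → ∃ t : Fin k, (∀ a ∈ A (u i t), ∀ a' ∈ A (u j t), ∀ b ∈ B (u j t), ∀ b' ∈ B (u m t), ∀ c ∈ C (u m t), ∀ c' ∈ C (u i t), ¬ (ℓ : ℤ) ∣ ((a : ℤ) - a') + ((b : ℤ) - b') + ((c : ℤ) - c')) ∧ ((t : ℕ) = 0 ∨ ∃ t' : Fin k, (t' : ℕ) + 1 = t ∧ u i t' = u j t' ∧ u j t' = u m t')) → Literature.Combinatorics.Additive.AddSimultaneousTPP (G := ZMod (ℓ ^ k)) (fun i => (Fintype.piFinset fun t => A (u i t)).image fun d => (Literature.Computability.AutomaticStructures.digitValue d : ZMod (ℓ ^ k))) (fun i => (Fintype.piFinset fun t => B (u i t)).image fun d => (Literature.Computability.AutomaticStructures.digitValue d : ZMod (ℓ ^ k))) (fun i => (Fintype.piFinset fun t => C (u i t)).image fun d => (Literature.Computability.AutomaticStructures.digitValue d : ZMod (ℓ ^ k))) :=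
  fun _ _ _ _ _ A B C u hTPP hdiag hU => cyclicChart_addSimultaneousTPP A B C u hTPP hdiag hU

end AutomaticDesignBelowFourFifths

end Summit.MatrixMultiplication.MatrixMultiplication.Theorems
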